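import Mathlib.Dynamics.Ergodic.Conservative
import Summits.AnomalousDissipation.AnomalousDissipation.Theorems.BaireTransferDenseLoudDesignerForcesStubBirkhoffMeans

/-!
# Stub 4a `stub_recurrence` of the line `ergodic-budget-selection-closing`
# (crux `BaireTransfer.DenseLoudDesignerForces`, stmt-AnomalousDissipation-1143)

Sorry-free discharge of the registered stub `stub_recurrence` of the lead's skeleton
(`Cruxes/DenseLoudDesignerForces/Lines/ergodic-budget-selection-closing.lean`) over the landed line vocabulary
`Theorems/BaireTransferDenseLoudDesignerForcesErgodicLine.lean` (namespace `…Theorems.DenseLoudDesignerForces.Ergodic`: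
`Hsp`, `IsNSPhase`, `IsInvariantMeasure`) and the plumbing of the sibling stub file
`Theorems/BaireTransferDenseLoudDesignerForcesStubBirkhoffMeans.lean` (measure-preserving measurable modification
of the time-one map and its iterates on `K`).

**Statement.**  For an NS phase `(K, φ)` (compact forward-invariant `K ⊂ H`, semiflow `φ`) and an invariant
Borel probability measure `μ` carried by `K`, every measurable `A ⊆ H` and every `r > 0`: for `μ`-a.e. `x`, if
`x ∈ A` then at infinitely many INTEGER times `n` the trajectory is back in `A` and within distance `r` of its
start, `φ_n x ∈ A ∧ dist (φ_n x) x < r`.  Pure measure theory (Poincaré recurrence); no PDE is used.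

**Proof.**  The modification `f = K.piecewise (φ 1) id` of the time-one map preserves the probability measure
`μ`, hence is conservative (`MeasurePreserving.conservative`), and `f^[n] = φ_n` on `K`
(`stub_birkhoffMeans_aux_measurePreserving`, `stub_birkhoffMeans_aux_iterate`).  The compact `K` is separable:
`K ⊆ closure c` for a countable `c`.  For each `b ∈ c` Poincaré recurrence
(`Conservative.ae_mem_imp_frequently_image_mem`) applied to the measurable set `A ∩ B(b, r/2)` says that a.e.
point of it returns to it infinitely often; intersecting these countably many full-measure sets with `{x ∈ K}`,
a point `x ∈ A ∩ K` lies in some `B(b, r/2)`, and each return `f^[n] x ∈ A ∩ B(b, r/2)` is a return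
`φ_n x ∈ A` with `dist (φ_n x) x < r/2 + r/2 = r`.

References: H. Poincaré, Acta Math. 13 (1890) (recurrence); Foias–Manley–Rosa–Temam, *Navier–Stokes Equations
and Turbulence* (CUP 2001) Ch. IV §2 (invariant measures of the NS semiflow); Mathlib
`Mathlib/Dynamics/Ergodic/Conservative.lean` (Poincaré recurrence for conservative maps).
-/

set_option linter.dupNamespace false

noncomputable section

open scoped BigOperators Topology ENNReal InnerProductSpace
open Filter Set Function MeasureTheory

namespace Summit.AnomalousDissipation.AnomalousDissipation.Theorems.DenseLoudDesignerForces.Ergodic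

open Literature.Analysis.FunctionSpaces Literature.Analysis.FunctionSpaces.Torus
open Literature.Analysis.FluidPDE Literature.Analysis.FluidPDE.Torus
open Summit.AnomalousDissipation.AnomalousDissipation.Theses.BaireTransfer
open Summit.AnomalousDissipation.AnomalousDissipation.Theorems.DenseLoudDesignerForces.Negative

/-! ## Poincaré recurrence at integer times for the NS semiflow (stub 4a of the line) -/

section Recurrence

variable {ν : ℝ} {F : (UnitAddTorus (Fin 3)) → (EuclideanSpace ℝ (Fin 3))} {K : Set Hsp} {φ : ℝ → Hsp → Hsp}
  {μ : Measure Hsp}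

/-- Localised Poincaré recurrence for a measure-preserving self-map `f` of the probability space `(H, μ)`:
for every point `b` and radius `ρ`, `μ`-a.e. point of `A ∩ B(b, ρ)` returns to `A ∩ B(b, ρ)` under infinitely
many iterates of `f` (a self-map preserving a finite measure is conservative). [folklore] -/
theorem stub_recurrence_aux_local (hμ : IsInvariantMeasure K φ μ) {f : Hsp → Hsp}
    (hf : MeasurePreserving f μ μ) {A : Set Hsp} (hA : MeasurableSet A) (b : Hsp) (ρ : ℝ) :
    ∀ᵐ x ∂μ, x ∈ A ∩ Metric.ball b ρ → ∃ᶠ n : ℕ in atTop, f^[n] x ∈ A ∩ Metric.ball b ρ := by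
  haveI := hμ.prob
  exact hf.conservative.ae_mem_imp_frequently_image_mem (hA.inter measurableSet_ball).nullMeasurableSet

/-- **Stub 4a of the line `ergodic-budget-selection-closing`: recurrence at integer times.**
For an NS phase `(K, φ)` with an invariant probability measure `μ` carried by `K`, a measurable set `A` and
`r > 0`: for `μ`-a.e. `x ∈ A` there are infinitely many integer times `n` with `φ_n x ∈ A` and
`dist (φ_n x) x < r` (Poincaré recurrence for the conservative time-one map applied to the countably many sets
`A ∩ B(b, r/2)`, `b` ranging over a countable set dense in the compact `K`). [folklore] -/
theorem stub_recurrence {ν : ℝ} {F : (UnitAddTorus (Fin 3)) → (EuclideanSpace ℝ (Fin 3))} {K : Set Hsp} {φ : ℝ → Hsp → Hsp} {μ : Measure Hsp} (hK : IsNSPhase ν F K φ) (hμ : IsInvariantMeasure K φ μ) {A : Set Hsp} (hA : MeasurableSet A) {r : ℝ} (hr : 0 < r) : ∀ᵐ x ∂μ, x ∈ A → ∃ᶠ n : ℕ in atTop, φ n x ∈ A ∧ dist (φ n x) x < r := by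
  obtain ⟨f, hf, hfK⟩ := stub_birkhoffMeans_aux_measurePreserving hK hμ
  obtain ⟨c, hc, hKc⟩ := hK.isCompact.isSeparable
  have hball : ∀ b ∈ c, ∀ᵐ x ∂μ, x ∈ A ∩ Metric.ball b (r / 2) →
      ∃ᶠ n : ℕ in atTop, f^[n] x ∈ A ∩ Metric.ball b (r / 2) :=
    fun b _ => stub_recurrence_aux_local hμ hf hA b (r / 2)
  filter_upwards [(ae_ball_iff hc).2 hball, hμ.ae_mem] with x hx hxK hxA
  obtain ⟨b, hb, hxb⟩ := Metric.mem_closure_iff.1 (hKc hxK) (r / 2) (half_pos hr)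
  refine (hx b hb ⟨hxA, Metric.mem_ball.2 hxb⟩).mono fun n hn => ?_
  rw [← stub_birkhoffMeans_aux_iterate hK hfK hxK n]
  refine ⟨hn.1, ?_⟩
  calc dist (f^[n] x) x ≤ dist (f^[n] x) b + dist b x := dist_triangle _ _ _
    _ < r / 2 + r / 2 := add_lt_add (Metric.mem_ball.1 hn.2) (by rwa [dist_comm])
    _ = r := add_halves r

end Recurrence

end Summit.AnomalousDissipation.AnomalousDissipation.Theorems.DenseLoudDesignerForces.Ergodic

end
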